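import Summits.CriticalPhenomena.PercolationContinuityZ3.Theses.PercNearOneGluing
import Literature.Probability.Percolation.PercolationEvents
import HarnessLib.Audit
import Summits.CriticalPhenomena.PercolationContinuityZ3.Theorems.PercNearOneGluingNearOneGluingVariants2415

/-! TTRL-lite variant V2453 of stmt-CriticalPhenomena-4574

(`stub_shorteningStep` of line `kn_shortening_induction`, move `small_case+small_case`:
`A.card ≤ 1` and `n ≤ 5`).  This variant is a weakening of the already-landed sibling variant
V2415 (`A.card ≤ 2` alone, `stub_shorteningStep_var2415`): `A.card ≤ 1` implies `A.card ≤ 2` and the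
extra hypothesis `n ≤ 5` is simply discarded.  (Mathematically, V2415 is Kozma–Nitzan's shortening
step, Conjecture 6 of arXiv:2401.12397 measured against the minimiser `a₀` of the uncontracted
graph, for at most two relays; with `A.card ≤ 1` and `a₀ ∈ A` the relay set is the singleton `{a₀}`
and the step is Harris' inequality after transport to the uncontracted measure — see the docstring
of V2415.)  No new definitions, no named facts, the induction hypothesis is not used. -/

namespace Summit.CriticalPhenomena.PercolationContinuityZ3.Theorems

open MeasureTheory Set Literature.Probability.LatticeModels Literature.Probability.Percolation
open scoped Classical BigOperators

/-- TTRL-lite variant V2453 of `stub_shorteningStep` (stmt-CriticalPhenomena-4574, Kozma–Nitzan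
Conjecture 6 with the induction hypothesis displayed): the shortening step
`μ(⋃ a ∈ A, v ↔ a) · μ(a₀ ↔ b) ≤ μ(v ↔ b)` for the glued measure `μ = prodBernoulli (w[s(v,x) ↦ 1])`
in the small case `A.card ≤ 1`, `n ≤ 5`.  Immediate from the sibling variant
`stub_shorteningStep_var2415` (case `A.card ≤ 2`, any `n`). -/
theorem stub_shorteningStep_var2453 : ∀ (n : ℕ) (w : Sym2 (Fin n) → unitInterval) (A : Finset (Fin n)) (b v x a₀ : Fin n), A.card ≤ 1 → n ≤ 5 → v ∉ A → v ≠ x → w s(v, x) = 0 → a₀ ∈ A → (∀ a ∈ A, (prodBernoulli w).real (openConn a₀ b) ≤ (prodBernoulli w).real (openConn a b)) → (∀ w' : Sym2 (Fin n) → unitInterval, (∀ e, w e = 0 → w' e = 0) → ∀ (A' : Finset (Fin n)) (o' b' : Fin n) (t : ℝ), (∀ a ∈ A', t ≤ (prodBernoulli w').real (openConn a b')) → (prodBernoulli w').real (⋃ a ∈ A', openConn o' a) * t ≤ (prodBernoulli w').real (openConn o' b')) → (prodBernoulli (Function.update w s(v, x) 1)).real (⋃ a ∈ A, openConn v a) *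 (prodBernoulli (Function.update w s(v, x) 1)).real (openConn a₀ b) ≤ (prodBernoulli (Function.update w s(v, x) 1)).real (openConn v b) := by
  intro n w A b v x a₀ hcard _hn
  exact stub_shorteningStep_var2415 n w A b v x a₀ (le_trans hcard (by norm_num))

end Summit.CriticalPhenomena.PercolationContinuityZ3.Theorems
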